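import Literature.NumberTheory.LFunctions.PolyaSignChangesPolePair

/-!
# Pole-pair asymptotics of the Taylor coefficients at a real point (sequel)

Topic `Literature/NumberTheory/LFunctions` (namespace `Literature.NumberTheory.LFunctions`,
grouping sub-namespace `PolyaSignChanges`).  Part of the A1 formalisation of Pólya's sign-change
theorem (`PolyaSignChanges.Grosswald1967_thmB`) by the moment method (cell pub/rh-inputs,
PieceA; quantitative `stub_polePair_taylor`).  Nothing in this file bears on the truth of RH.

## Content (all proved, sorry-free)

With the data of `polePair_decomposition` (real point `λ`, pole pair `ρ, ρ̄` of order `m ≥ 1`,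
leading Laurent coefficient `A ≠ 0`, `R = |λ − ρ|`, `φ = arctan(im ρ/(λ − re ρ))` so that
`λ − ρ = R e^{−iφ}`, `α = arg A`):

* `ofReal_sub_eq_norm_mul_exp`, `re_mul_inv_pow_eq`: polar-form bookkeeping,
  `Re(A q (λ−ρ)^{−n}) = |A| q R^{−n} cos(nφ + α)`.
* `ascFactorial_sub_le`: `(m'−j)^{(k)} ≤ (m'/(m'+k)) (m'+1)^{(k)}` (lower Laurent terms are `O(1/k)`).
* `polePair_asymptotics`: `(-1)^k Re Ψ^{(k)}(λ)/k! = N_k (cos((m+k)φ + α) + ε_k)` with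
  `ε_k → 0` and `N_k = 2|A| binom(m+k−1,k) R^{−(m+k)} ≥ c₀ R^{−k}` (`c₀ > 0`).

## References

* E. Grosswald, *Oscillation theorems of arithmetical functions*, TAMS 126 (1967) 1–28, §4 Thm B.
  [Grosswald1967]
-/

noncomputable section

open Complex Set Filter Topology Metric Finset

open scoped ComplexConjugate

namespace Literature.NumberTheory.LFunctions

namespace PolyaSignChanges

/-- Taylor coefficients on a larger disc are geometrically small: if `E` is holomorphic on
`ball c R'` and `0 < R₁ < R'` then `‖E^{(k)}(c)‖/k! · R₁^k` is bounded in `k` (the terms of the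
convergent Taylor series at `c + R₁` tend to zero). [folklore] -/
private theorem exists_bound_iteratedDeriv_of_differentiableOn_ball {E : ℂ → ℂ} {c : ℂ} {R' R₁ : ℝ}
    (hE : DifferentiableOn ℂ E (ball c R')) (hR₁ : 0 < R₁) (hR₁' : R₁ < R') :
    ∃ B : ℝ, ∀ k : ℕ, ‖iteratedDeriv k E c‖ / k.factorial * R₁ ^ k ≤ B := by
  have hz : c + R₁ ∈ ball c R' := by
    simp [Metric.mem_ball, dist_eq_norm, abs_of_pos hR₁, hR₁']
  have hsum := Complex.hasSum_taylorSeries_on_ball hE hz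
  have h0 := hsum.summable.tendsto_atTop_zero
  have h1 : Tendsto (fun k : ℕ => ‖iteratedDeriv k E c‖ / k.factorial * R₁ ^ k) atTop (𝓝 0) := by
    have := (tendsto_zero_iff_norm_tendsto_zero.1 h0)
    refine this.congr fun k => ?_
    simp only [add_sub_cancel_left, norm_smul, norm_inv, norm_pow,
      Complex.norm_real, Real.norm_eq_abs, abs_of_pos hR₁, Complex.norm_natCast]
    ring
  obtain ⟨B, hB⟩ := h1.bddAbove_range
  exact ⟨B, fun k => hB ⟨k, rfl⟩⟩


/-! ### Real bookkeeping: polar form of `(λ − ρ)⁻¹` and the asymptotics of the coefficients -/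

/-- Polar form: for real `λ > re ρ` and `im ρ > 0`, `λ − ρ = R e^{-iφ}` with `R = |λ − ρ|`,
`φ = arctan(im ρ/(λ − re ρ))`. [folklore] -/
private theorem ofReal_sub_eq_norm_mul_exp {lam : ℝ} {ρ : ℂ} (hre : ρ.re < lam) :
    (lam : ℂ) - ρ = (‖(lam : ℂ) - ρ‖ : ℂ) *
      exp (-(Real.arctan (ρ.im / (lam - ρ.re)) : ℂ) * I) := by
  set R : ℝ := ‖(lam : ℂ) - ρ‖ with hR_def
  set d : ℝ := lam - ρ.re with hd_def
  have hd : 0 < d := sub_pos.2 hre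
  set φ : ℝ := Real.arctan (ρ.im / d) with hφ_def
  have hre' : ((lam : ℂ) - ρ).re = d := by simp [hd_def]
  have him' : ((lam : ℂ) - ρ).im = -ρ.im := by simp
  have hRsq : R ^ 2 = d ^ 2 + ρ.im ^ 2 := by
    rw [hR_def, ← Complex.normSq_eq_norm_sq, Complex.normSq_apply, hre', him']; ring
  have hR0 : 0 ≤ R := norm_nonneg _
  have hsqrt : Real.sqrt (1 + (ρ.im / d) ^ 2) = R / d := by
    have h1 : 1 + (ρ.im / d) ^ 2 = (R / d) ^ 2 := by
      rw [div_pow, div_pow, hRsq]; field_simp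
    rw [h1, Real.sqrt_sq (div_nonneg hR0 hd.le)]
  have hcos : Real.cos φ = d / R := by
    rw [hφ_def, Real.cos_arctan, hsqrt, one_div, inv_div]
  have hsin : Real.sin φ * R = ρ.im := by
    rw [hφ_def, Real.sin_arctan, hsqrt]
    rcases eq_or_lt_of_le hR0 with h | h
    · -- degenerate `R = 0` cannot happen (`d > 0`), but the algebra closes anyway
      have : d ^ 2 + ρ.im ^ 2 = 0 := by rw [← hRsq, ← h]; ring
      nlinarith
    · field_simp
  apply Complex.ext
  · rw [hre', show (-(φ : ℂ)) * I = ((-φ : ℝ) : ℂ) * I by push_cast; ring, Complex.re_ofReal_mul,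
      Complex.exp_ofReal_mul_I_re, Real.cos_neg, hcos]
    rcases eq_or_lt_of_le hR0 with h | h
    · have : d ^ 2 + ρ.im ^ 2 = 0 := by rw [← hRsq, ← h]; ring
      nlinarith
    · field_simp
  · rw [him', show (-(φ : ℂ)) * I = ((-φ : ℝ) : ℂ) * I by push_cast; ring, Complex.im_ofReal_mul,
      Complex.exp_ofReal_mul_I_im, Real.sin_neg, mul_neg, mul_comm, hsin]

/-- Real part of the pole-pair main term: `Re(A q (λ−ρ)^{-n}) = |A| q R^{-n} cos(nφ + arg A)`.
[folklore] -/
private theorem re_mul_inv_pow_eq {lam : ℝ} {ρ : ℂ} (hre : ρ.re < lam) (A : ℂ) (q : ℝ) (n : ℕ) :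
    (A * (q : ℂ) * ((lam : ℂ) - ρ)⁻¹ ^ n).re =
      ‖A‖ * q * ‖(lam : ℂ) - ρ‖⁻¹ ^ n *
        Real.cos (n * Real.arctan (ρ.im / (lam - ρ.re)) + arg A) := by
  set R : ℝ := ‖(lam : ℂ) - ρ‖ with hR_def
  set φ : ℝ := Real.arctan (ρ.im / (lam - ρ.re)) with hφ_def
  have hpol := ofReal_sub_eq_norm_mul_exp hre
  rw [← hR_def, ← hφ_def] at hpol
  have hu : ((lam : ℂ) - ρ)⁻¹ ^ n = ((R⁻¹ ^ n : ℝ) : ℂ) * exp (((n : ℝ) * φ : ℝ) * I) := by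
    rw [hpol, mul_inv, ← Complex.exp_neg, mul_pow, ← Complex.exp_nat_mul]
    push_cast
    ring_nf
  have hA : A = (‖A‖ : ℂ) * exp ((arg A : ℂ) * I) := (norm_mul_exp_arg_mul_I A).symm
  have : A * (q : ℂ) * ((lam : ℂ) - ρ)⁻¹ ^ n
      = ((‖A‖ * q * R⁻¹ ^ n : ℝ) : ℂ) * exp ((((n : ℝ) * φ + arg A : ℝ) : ℂ) * I) := by
    rw [hu]
    nth_rewrite 1 [hA]
    rw [show ((((n : ℝ) * φ + arg A : ℝ) : ℂ) * I) = (arg A : ℂ) * I + (((n : ℝ) * φ : ℝ) : ℂ) * I by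
      push_cast; ring, Complex.exp_add]
    push_cast
    ring
  rw [this, Complex.re_ofReal_mul, Complex.exp_ofReal_mul_I_re]

/-- The ascending-factorial ratio that kills the lower-order Laurent terms:
`(m'−j)^{(k)} ≤ (m'/(m'+k)) · (m'+1)^{(k)}` for `j < m'`. [folklore] -/
private theorem ascFactorial_sub_le {m' j : ℕ} (hj : j < m') (k : ℕ) :
    ((m' - j).ascFactorial k : ℝ) ≤ (m' : ℝ) / ((m' : ℝ) + k) * ((m' + 1).ascFactorial k : ℝ) := by
  have h1 : ((m' - j).ascFactorial k : ℝ) ≤ (m'.ascFactorial k : ℝ) := by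
    exact_mod_cast Nat.ascFactorial_le k (Nat.sub_le m' j)
  have h2 : (m' : ℝ) * ((m' + 1).ascFactorial k : ℝ) = ((m' : ℝ) + k) * (m'.ascFactorial k : ℝ) := by
    exact_mod_cast Nat.succ_ascFactorial m' k
  have hpos : (0 : ℝ) < (m' : ℝ) + k := by
    have : (0 : ℝ) < m' := by exact_mod_cast (Nat.zero_lt_of_lt hj)
    positivity
  rw [div_mul_eq_mul_div, h2, le_div_iff₀ hpos]
  nlinarith

/-- **Pole-pair asymptotics of the Taylor coefficients at a real point** (the quantitative form
of `stub_polePair_taylor`).  Under the hypotheses of `polePair_decomposition` (pole order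
`m ≥ 1`, `A ≠ 0`, `re ρ < λ`):
`(-1)^k Re Ψ^{(k)}(λ)/k! = N_k (cos((m+k)φ + α) + ε_k)` with `ε_k → 0`,
`N_k = 2|A| binom(m+k-1,k) R^{-(m+k)} ≥ c₀ R^{-k}`, `R = |λ−ρ|`, `φ = arctan(γ/(λ−β))`, `α = arg A`.
[cite: Grosswald1967, §4 Thm B (moment method: pole-pair asymptotics of the Taylor coefficients)] -/
theorem polePair_asymptotics {Ψ : ℂ → ℂ} {lam R' : ℝ} {ρ A : ℂ} {m : ℕ}
    (him : 0 < ρ.im) (hre : ρ.re < lam) (hR' : ‖(lam : ℂ) - ρ‖ < R')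
    (hdiff : DifferentiableOn ℂ Ψ (closedBall (lam : ℂ) R' \ {ρ, conj ρ}))
    (hsymm : ∀ s ∈ closedBall (lam : ℂ) R', Ψ (conj s) = conj (Ψ s))
    (hm : 1 ≤ m) (hA : A ≠ 0)
    (hpole : Tendsto (fun s : ℂ => (s - ρ) ^ m * Ψ s) (𝓝[≠] ρ) (𝓝 A)) :
    ∃ (α c₀ : ℝ) (N ε : ℕ → ℝ), 0 < c₀ ∧ Tendsto ε atTop (𝓝 0) ∧
      (∀ k, c₀ * ‖(lam : ℂ) - ρ‖⁻¹ ^ k ≤ N k) ∧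
      ∀ k, (-1) ^ k * (iteratedDeriv k Ψ (lam : ℂ)).re / k.factorial =
        N k * (Real.cos ((m + k : ℝ) * Real.arctan (ρ.im / (lam - ρ.re)) + α) + ε k) := by
  obtain ⟨a, E, ha0, hE, hT⟩ := polePair_decomposition him hR' hdiff hsymm hpole
  obtain ⟨m', rfl⟩ : ∃ m', m = m' + 1 := ⟨m - 1, by omega⟩
  set c : ℂ := (lam : ℂ) with hc_def
  set R : ℝ := ‖c - ρ‖ with hR_def
  have hcρ_im : (c - ρ).im = -ρ.im := by simp [hc_def]
  have hR0 : 0 < R := by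
    have : c - ρ ≠ 0 := fun h => by
      have := congrArg Complex.im h; simp [hcρ_im] at this; linarith
    simpa [hR_def] using this
  have hR'0 : 0 < R' := hR0.trans hR'
  have hA0 : 0 < ‖A‖ := norm_pos_iff.2 hA
  set φ : ℝ := Real.arctan (ρ.im / (lam - ρ.re)) with hφ_def
  set u : ℂ := (c - ρ)⁻¹ with hu_def
  have hu_norm : ‖u‖ = R⁻¹ := by rw [hu_def, norm_inv]
  -- the normaliser and the error
  set N : ℕ → ℝ := fun k =>
    2 * ‖A‖ * (((m' + 1).ascFactorial k : ℝ) / k.factorial) * R⁻¹ ^ (m' + 1 + k) with hN_def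
  have hasc1 : ∀ k : ℕ, (1 : ℝ) ≤ ((m' + 1).ascFactorial k : ℝ) / k.factorial := by
    intro k
    rw [le_div_iff₀ (by positivity), one_mul]
    exact_mod_cast (Nat.one_ascFactorial k).symm.le.trans (Nat.ascFactorial_le k hm)
  have hN_pos : ∀ k, 0 < N k := fun k => by
    have := hasc1 k; simp only [hN_def]; positivity
  have hN_low : ∀ k, 2 * ‖A‖ * R⁻¹ ^ (m' + 1) * R⁻¹ ^ k ≤ N k := fun k => by
    have h0 : 0 ≤ 2 * ‖A‖ * R⁻¹ ^ (m' + 1) * R⁻¹ ^ k := by positivity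
    have : N k = (((m' + 1).ascFactorial k : ℝ) / k.factorial) *
        (2 * ‖A‖ * R⁻¹ ^ (m' + 1) * R⁻¹ ^ k) := by
      simp only [hN_def, pow_add]; ring
    rw [this]
    exact le_mul_of_one_le_left h0 (hasc1 k)
  set T : ℕ → ℝ := fun k => (-1) ^ k * (iteratedDeriv k Ψ c).re / k.factorial with hT_def
  set ε : ℕ → ℝ := fun k => T k / N k - Real.cos ((m' + 1 + k : ℝ) * φ + arg A) with hε_def
  have hid : ∀ k : ℕ, (-1) ^ k * (iteratedDeriv k Ψ c).re / k.factorial =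
      N k * (Real.cos (((m' + 1 : ℕ) + k : ℝ) * φ + arg A) + ε k) := by
    intro k
    have hN0 : N k ≠ 0 := (hN_pos k).ne'
    have : T k = N k * (Real.cos ((m' + 1 + k : ℝ) * φ + arg A) + ε k) := by
      simp only [hε_def]; field_simp; ring
    simpa [hT_def] using this
  suffices hlim : Tendsto ε atTop (𝓝 0) from
    ⟨arg A, 2 * ‖A‖ * R⁻¹ ^ (m' + 1), N, ε, by positivity, hlim, hN_low, hid⟩
  -- the limit `ε k → 0`
  -- (a) the normalised Laurent sum and its split into the leading term and the rest
  set Q' : ℕ → ℂ := fun k => ∑ j ∈ range m', a (j + 1) *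
      ((((m' - j).ascFactorial k : ℝ) / k.factorial : ℝ) : ℂ) * u ^ (m' - j + k) with hQ'_def
  set e : ℕ → ℂ := fun k => iteratedDeriv k E c with he_def
  have hTk : ∀ k, T k = N k * Real.cos ((m' + 1 + k : ℝ) * φ + arg A) +
      (2 * (Q' k).re + (-1) ^ k * (e k).re / k.factorial) := by
    intro k
    have hk0 : (k.factorial : ℂ) ≠ 0 := Nat.cast_ne_zero.2 (Nat.factorial_ne_zero k)
    -- the full normalised sum
    set Q : ℂ := ∑ j ∈ range (m' + 1), a j *
      ((((m' + 1 - j).ascFactorial k : ℝ) / k.factorial : ℝ) : ℂ) * u ^ (m' + 1 - j + k) with hQ_def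
    have hS : (∑ j ∈ range (m' + 1), a j * ((-1) ^ k * ((m' + 1 - j).ascFactorial k : ℂ) *
        u ^ (m' + 1 - j + k))) = (-1) ^ k * (k.factorial : ℂ) * Q := by
      rw [hQ_def, mul_sum]
      refine sum_congr rfl fun j _ => ?_
      push_cast
      field_simp
    have hTre : (iteratedDeriv k Ψ c).re = 2 * ((-1) ^ k * (k.factorial : ℝ) * Q.re) + (e k).re := by
      rw [hT k, hS]
      simp only [add_re, Complex.conj_re, he_def]
      have : ((-1 : ℂ) ^ k * (k.factorial : ℂ) * Q).re = (-1) ^ k * (k.factorial : ℝ) * Q.re := by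
        rw [show ((-1 : ℂ) ^ k * (k.factorial : ℂ)) = (((-1 : ℝ) ^ k * k.factorial : ℝ) : ℂ) by
          push_cast; ring, Complex.re_ofReal_mul]
      rw [this]; ring
    -- split off `j = 0`
    have hQsplit : Q = A * ((((m' + 1).ascFactorial k : ℝ) / k.factorial : ℝ) : ℂ) *
        u ^ (m' + 1 + k) + Q' k := by
      rw [hQ_def, sum_range_succ', ha0, hQ'_def, add_comm]
      congr 1
      refine sum_congr rfl fun j _ => ?_
      simp only [Nat.add_sub_add_right]
    have hmain : (A * ((((m' + 1).ascFactorial k : ℝ) / k.factorial : ℝ) : ℂ) *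
        u ^ (m' + 1 + k)).re = N k / 2 * Real.cos ((m' + 1 + k : ℝ) * φ + arg A) := by
      rw [hu_def, hc_def, re_mul_inv_pow_eq hre, hN_def, ← hφ_def, ← hR_def]
      beta_reduce
      push_cast
      ring
    simp only [hT_def]
    rw [hTre, hQsplit, add_re, hmain]
    have h1 : ((-1 : ℝ) ^ k) ^ 2 = 1 := by rw [← pow_mul, mul_comm, pow_mul, neg_one_sq, one_pow]
    field_simp
    linear_combination (2 * (↑k.factorial : ℝ) * (N k / 2 * Real.cos ((↑m' + 1 + ↑k) * φ + arg A)) +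
      2 * (↑k.factorial : ℝ) * (Q' k).re) * h1
  -- (b) Taylor bound for `E` on a disc of radius `R₁ ∈ (R, R')`
  set R₁ : ℝ := (R + R') / 2 with hR₁_def
  have hR₁0 : 0 < R₁ := by positivity
  have hRR₁ : R < R₁ := by rw [hR₁_def]; linarith
  have hR₁R' : R₁ < R' := by rw [hR₁_def]; linarith
  obtain ⟨B, hB⟩ := exists_bound_iteratedDeriv_of_differentiableOn_ball hE hR₁0 hR₁R'
  have hB0 : 0 ≤ B := le_trans (by positivity) (hB 0)
  -- (c) the bound `|ε k| ≤ C₁ m'/(m'+k) + C₂ (R/R₁)^k`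
  set C₁ : ℝ := ∑ j ∈ range m', ‖a (j + 1)‖ * R ^ (j + 1) / ‖A‖ with hC₁_def
  set C₂ : ℝ := B * R ^ (m' + 1) / (2 * ‖A‖) with hC₂_def
  have hbound : ∀ k, |ε k| ≤ C₁ * ((m' : ℝ) / ((m' : ℝ) + k)) + C₂ * (R / R₁) ^ k := by
    intro k
    have hNk := hN_pos k
    have hk0 : (0 : ℝ) < k.factorial := by positivity
    have hεk : ε k = (2 * (Q' k).re + (-1) ^ k * (e k).re / k.factorial) / N k := by
      simp only [hε_def]; rw [hTk k]; field_simp; ring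
    -- the lower-order Laurent terms
    have hQ' : 2 * ‖Q' k‖ ≤ C₁ * ((m' : ℝ) / ((m' : ℝ) + k)) * N k := by
      calc 2 * ‖Q' k‖ ≤ 2 * ∑ j ∈ range m', ‖a (j + 1)‖ *
            (((m' - j).ascFactorial k : ℝ) / k.factorial) * R⁻¹ ^ (m' - j + k) := by
            gcongr
            refine (norm_sum_le _ _).trans (sum_le_sum fun j _ => le_of_eq ?_)
            rw [norm_mul, norm_mul, Complex.norm_real, Real.norm_eq_abs,
              abs_of_nonneg (by positivity), norm_pow, hu_norm]
        _ ≤ 2 * ∑ j ∈ range m', ‖a (j + 1)‖ *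
            ((m' : ℝ) / ((m' : ℝ) + k) * (((m' + 1).ascFactorial k : ℝ) / k.factorial)) *
            (R ^ (j + 1) * R⁻¹ ^ (m' + 1 + k)) := by
            gcongr with j hj
            · rw [mul_div_assoc']
              exact div_le_div_of_nonneg_right (ascFactorial_sub_le (mem_range.1 hj) k) hk0.le
            · apply le_of_eq
              have hj' := mem_range.1 hj
              have e1 : R⁻¹ ^ (m' + 1 + k) = R⁻¹ ^ (j + 1) * R⁻¹ ^ (m' - j + k) := by
                rw [← pow_add]; congr 1; omega
              rw [e1, ← mul_assoc, ← mul_pow, mul_inv_cancel₀ hR0.ne', one_pow, one_mul]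
        _ = C₁ * ((m' : ℝ) / ((m' : ℝ) + k)) * N k := by
            rw [hC₁_def, hN_def, mul_sum, sum_mul, sum_mul]
            refine sum_congr rfl fun j _ => ?_
            field_simp
    -- the regular part
    have he : ‖e k‖ / k.factorial ≤ C₂ * (R / R₁) ^ k * N k := by
      have h1 : ‖e k‖ / k.factorial ≤ B / R₁ ^ k := by
        rw [le_div_iff₀ (pow_pos hR₁0 k)]; exact hB k
      have h2 : C₂ * (R / R₁) ^ k * (2 * ‖A‖ * R⁻¹ ^ (m' + 1) * R⁻¹ ^ k) = B / R₁ ^ k := by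
        have hA2 : (2 * ‖A‖) ≠ 0 := by positivity
        have hRk : R ^ k * R⁻¹ ^ k = 1 := by
          rw [← mul_pow, mul_inv_cancel₀ hR0.ne', one_pow]
        have hRm : R ^ (m' + 1) * R⁻¹ ^ (m' + 1) = 1 := by
          rw [← mul_pow, mul_inv_cancel₀ hR0.ne', one_pow]
        rw [hC₂_def, div_pow]
        calc B * R ^ (m' + 1) / (2 * ‖A‖) * (R ^ k / R₁ ^ k) *
              (2 * ‖A‖ * R⁻¹ ^ (m' + 1) * R⁻¹ ^ k)
            = B / R₁ ^ k * (R ^ (m' + 1) * R⁻¹ ^ (m' + 1)) * (R ^ k * R⁻¹ ^ k) *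
                ((2 * ‖A‖) / (2 * ‖A‖)) := by ring
          _ = B / R₁ ^ k := by rw [hRk, hRm, div_self hA2]; ring
      have h3 : 0 ≤ C₂ * (R / R₁) ^ k := by positivity
      calc ‖e k‖ / k.factorial ≤ B / R₁ ^ k := h1
        _ = C₂ * (R / R₁) ^ k * (2 * ‖A‖ * R⁻¹ ^ (m' + 1) * R⁻¹ ^ k) := h2.symm
        _ ≤ C₂ * (R / R₁) ^ k * N k := mul_le_mul_of_nonneg_left (hN_low k) h3
    -- combine
    rw [hεk, abs_div, abs_of_pos hNk, div_le_iff₀ hNk]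
    calc |2 * (Q' k).re + (-1) ^ k * (e k).re / k.factorial|
        ≤ |2 * (Q' k).re| + |(-1) ^ k * (e k).re / k.factorial| := abs_add_le _ _
      _ ≤ 2 * ‖Q' k‖ + ‖e k‖ / k.factorial := by
          gcongr
          · rw [abs_mul, abs_two]
            exact mul_le_mul_of_nonneg_left (Complex.abs_re_le_norm _) zero_le_two
          · rw [abs_div, abs_mul, abs_pow, abs_neg, abs_one, one_pow, one_mul,
              Nat.abs_cast]
            exact div_le_div_of_nonneg_right (Complex.abs_re_le_norm _) hk0.le
      _ ≤ C₁ * ((m' : ℝ) / ((m' : ℝ) + k)) * N k + C₂ * (R / R₁) ^ k * N k := add_le_add hQ' he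
      _ = (C₁ * ((m' : ℝ) / ((m' : ℝ) + k)) + C₂ * (R / R₁) ^ k) * N k := by ring
  -- (d) conclude
  have hlim0 : Tendsto (fun k : ℕ => C₁ * ((m' : ℝ) / ((m' : ℝ) + k)) + C₂ * (R / R₁) ^ k)
      atTop (𝓝 0) := by
    have h1 : Tendsto (fun k : ℕ => (m' : ℝ) / ((m' : ℝ) + k)) atTop (𝓝 0) :=
      tendsto_const_nhds.div_atTop
        (tendsto_atTop_add_const_left _ _ tendsto_natCast_atTop_atTop)
    have h2 : Tendsto (fun k : ℕ => (R / R₁) ^ k) atTop (𝓝 0) :=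
      tendsto_pow_atTop_nhds_zero_of_lt_one (by positivity) ((div_lt_one hR₁0).2 hRR₁)
    simpa using (h1.const_mul C₁).add (h2.const_mul C₂)
  exact squeeze_zero_norm (fun k => by rw [Real.norm_eq_abs]; exact hbound k) hlim0

end PolyaSignChanges

end Literature.NumberTheory.LFunctions

end
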